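import Literature.MathematicalPhysics.QuantumFieldTheory.Balaban1983to89.B8Prop7TowerAxialAdmissible

/-!
# `Balaban1983to89.B8IdxB8SubBCollarVacuity` — THE ρ = 0 VACUITY CERTIFICATE: print's (1.4) collar is NOT a law of NODE 00's sub-index of record
# `IdxB8SubB θ` — a LAWFUL member with EQUAL consecutive non-univ domains (print's tower `(T, □₁, …, □_k)` of (1.131) at collar width `R₁M₁ = 0`)
# violates the collar hypothesis of the two P-carrier (1.145) editions and is not `B8ConstraintBonds.DomainSeq`-admissible; hence
# `¬ ∀ j : IdxB8SubB θ, collar j` and `¬ ∀ j : IdxB8SubB θ, DomainSeq θ.L j.Ω` — the census exhibit for «(1.4) as an index law»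

statement-level skeleton of published theorems with citation tags; proofs where landed; nothing here is a claim about the Yang–Mills mass gap

T. Bałaban, *Spaces of regular gauge field configurations on a lattice and gauge fixing conditions*, Commun. Math. Phys. **99** (1985) 75–102
`[Balaban1985RegularSpaces]` ("B8"; journal page = PDF page + 74): (1.3)–(1.6) p. 77 («Ω₀ ⊃ Ω₁ ⊃ … ⊃ Ω_k», «(Lʲη)⁻¹dist(Ω_jᶜ, Ω_{j+1}) > RM₁», «we admit the case
where some domains Ω_j are equal to T_η»), p. 98 («□_j ⊃ □_{j+1} and a distance between boundaries of these cubes is equal to R₁M₁Lʲη»), (1.131) p. 99, (1.68) p. 88,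
(1.31) p. 82, p. 86 («𝔅_k»), Prop. 7 (1.145) p. 100.

## WHY THIS FILE (cell `pub-ymgap`, HUMAN RULING D-0062 ∕ D-0149; DAG node N05 = [B8]; width seat `pub-ymgap-dag-n05-w2` g2; proof lane, count-neutral; asked for by
## dag-n05-w1 g0, cell bus 2026-08-28 02:57Z «w2 certify: YES PLEASE — the ρ = 0 vacuity certificate is your piece»)

The two editions of [B8] Prop. 7's (1.145) on the P-carrier (`B8Prop7TowerAxialCollarP`, n05-w1 g0, p598716; `B8Prop7TowerAxialIneq145P`, this seat, p598518) and their
record faces display, PER MEMBER or as a SUB-FAMILY predicate, the collar hypothesis «the two-block box of a level-`j` bond with an end-block in `Ω_j` lies in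
`Ω_{j−1}`» — print's (1.4), which `B8Prop7TowerAxialAdmissible.collar_of_domainSeq` (this seat) derives from the tree's typed admissibility record
`B8ConstraintBonds.DomainSeq`.  A record face quantifying that hypothesis over ALL members of the sub-index of record `IdxB8SubB θ` (n05-w1's INTENT-11 v1,
withdrawn on this seat's located note, bus 02:52Z) would be VACUOUS AS TYPED (cell rule №189): the typed laws of `B8LeafModelZd.ZdIdx` + `B8IdxB8LawsB.IdxB8LawsB`
(nesting; hbox ∕ hclass ∕ htower ∕ hpart; №7 scale, №8 truncation, №11 cover, №12 bonds) do NOT separate `Ω_{j+1}` from the complement of `Ω_j` — print's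
«we admit … Ω_j = T_η» is typed without print's companion (1.4).  THIS FILE is the kernel certificate:
* §1 `exists_topCube_member_lawsB_anyWidth` — n05-c's lawful top-cube member `B8SockB9P3ShellModeVacuityUniv.exists_topCube_member_lawsB` RE-RUN FOR EVERY collar
  width `ρ` (there `ρ ≥ L` enters ONLY through the nesting field, taken from `cubeFam_domainSeq`; here nesting is read off `B8Eq131Cubes.cube_succ_subset`, which is
  width-free; every other line is n05-c's, credited) — so print's tower at `ρ = 0`, all of whose cubes `□_j`, `j ≥ 1`, COINCIDE with `Bᵏ(□)`, is a lawful member;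
* §2 `not_collar_cubeFam_true_zero` — at `ρ = 0`, `k ≥ 2`, `M ≥ 1`, `L ≥ 1`, `d ≥ 1` the collar hypothesis FAILS at level `2`: the bond `⟨Lᵏ⁻²a − e₀, Lᵏ⁻²a⟩` of the
  `2`-lattice has its second end-block inside `□₂ = Bᵏ(□)` and the corner of its first end-block outside `□₁ = Bᵏ(□)`; `not_domainSeq_cubeFam_true_zero`;
* §3 ★★ `exists_idxB8SubB_not_collar` ∕ `not_forall_idxB8SubB_collar` ∕ `not_forall_idxB8SubB_domainSeq` — for EVERY `θ : Stage3Params`: the sub-index of record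
  contains a lawful member (`k = 2`, `η = L⁻²`, `Ω = (ℤᵈ, Bᵏ(□), Bᵏ(□))`) at which the collar hypothesis and `DomainSeq`-admissibility both fail.
CONSEQUENCE (census, for plan g82 ∕ the node00-def lineage): (1.4) is an HONEST EXTRA HYPOTHESIS on `IdxB8SubB θ` — the collar sub-family
`{j ∕∕ collar j}` ⊋ ∅ (this seat's `exists_idxB8SubB_collar_topCube`) and the admissible sub-family `{j ∕∕ DomainSeq θ.L j.Ω}` ⊋ ∅ (`exists_idxB8SubB_domainSeq_topCube`) are
PROPER sub-families; making (1.4) unconditional means conjoining the EXISTING predicate `B8ConstraintBonds.DomainSeq θ.L i.Ω` to the index laws (a typer item, not a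
prover's).

## HONEST SCOPE

Index-law bookkeeping on print's own cube family at collar width `0` + one explicit lattice bond; NOTHING of Bałaban's analysis is asserted or used; the member of §1 at
`ρ = 0` is NOT print's geometry (print has `R₁M₁ ≥ 1`) — it is a witness that the TYPED index admits it.  Count-neutral; N05 NOT discharged; no count claim (the
chair's single count line is the only count); `T_η ↦ ℤᵈ`; one finite `𝕋⁴` programme at fixed `ε`, Bałaban AS PRINTED; the Yang–Mills mass gap (Clay) is NOT proved
by any of this — R4 closes the conditional finite-`𝕋⁴` rung `BalabanLadder.UV` only; nothing continuum ∕ ℝ⁴ ∕ OS.  No `sorry`, no `def`, no `instance`, no `notation`.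
Unit `pub-ymgap-dag-n05-w2` (g2), 2026-08-28.

RELATED IN THE TREE, NOT DUPLICATED: `B8SockB9P3ShellModeVacuityUniv.exists_topCube_member_lawsB` (n05-c: the `ρ ≥ L` member — §1 is its width-free re-run, proof
credited line by line), `B8CubeMemberZd` ∕ `B8CubeMemberIdxB8Laws` ∕ `B8SockHFPCubeMember` (n05-c: the tower geometry and laws, USED), `B8Prop7TowerAxialAdmissible` ∕
`B8Prop7TowerAxialIneq145P` (this seat: `collar_of_domainSeq`, the positive witnesses), `B8Prop7TowerAxialCollarP` ∕ `B8Prop7TowerAxialRecordP` (n05-w1 g0: the faces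
this certificate keeps per-member).

[cite: Balaban1985RegularSpaces, (1.3)–(1.6) p.77, p.98, (1.131) p.99, (1.68) p.88, (1.31) p.82, p.86, Prop. 7 (1.145) p.100]
-/

noncomputable section

namespace Literature.MathematicalPhysics.QuantumFieldTheory.Balaban1983to89.B8IdxB8SubBCollarVacuity

open B7Prop1Explicit B7Prop1Local
open B8Ineq130 (tlo thi tlo_apply thi_apply)
open B8Ineq132 (Under)
open B8Eq131Cubes (cube sqLo sqHi bLo bHi gs mem_cube_iff cube_succ_subset cube_eq)
open B8Eq131CubesAdmissible (cubeFam cubeFam_false_zero cubeFam_true_zero cubeFam_of_pos cubeFam_of_lt)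
open B8CubeMemberZd (cubeLam cubeLamS mem_cubeLam_zero_iff cubeLamS_of_lt cubeLamS_self htower_cubeLam hpart_cubeLam)
open B8IdxB8LawsB (towerBonds towerBonds_hbox towerBonds_hclass IdxB8LawsB IdxB8SubB)
open B8Eq191FlatLettersCubeMember (under_iff_blockMap_eq)
open B8ConstraintBonds (DomainSeq)
open B8LeafModelZd (ZdIdx)
open B8LeafModelZd3P (EndBlockIn inBox_loK_bondHiK_of_inBox_block)
open B8Prop7TowerAxialAdmissible (collar_of_domainSeq)
open Node00 (IdxB8Laws IdxB8 Stage3Params)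
open Literature.MathematicalPhysics.QuantumLattice (blockSites mem_blockSites_iff)

-- `Site` alone could resolve to the torus sites of `Setup.lean`; re-export the `ℤ^d` sites of `B7Prop1Explicit`.
export B7Prop1Explicit (Site)

variable {d : ℕ}

/-! ## §1 Print's tower `(T, □₁, …, □_k)` is a lawful member for EVERY collar width `ρ` (n05-c's construction, nesting read width-free) -/

section Member

variable {L : ℕ}

/-- **Nesting of `cubeFam true` for every width** (`□_{j+1} ⊂ □_j`, `B8Eq131Cubes.cube_succ_subset`, is width-free; `Ω_0 = ℤᵈ`; `Ω_j = ∅` above `k`).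
[cite: Balaban1985RegularSpaces, (1.3) p.77, p.98 («□_j ⊃ □_{j+1}»)] -/
theorem cubeFam_true_anti (L : ℕ) (a : Site d) (M ρ k : ℕ) : ∀ n, cubeFam true L a M ρ k (n + 1) ⊆ cubeFam true L a M ρ k n := by
  intro n
  rcases Nat.lt_or_ge k (n + 1) with hk | hk
  · rw [cubeFam_of_lt true L a M ρ hk]; exact Set.empty_subset _
  rcases Nat.eq_zero_or_pos n with rfl | hn
  · rw [cubeFam_true_zero]; exact Set.subset_univ _
  rw [cubeFam_of_pos true L a M ρ (by omega) hk, cubeFam_of_pos true L a M ρ hn (by omega)]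
  exact cube_succ_subset (by omega)

/-- ★ **PRINT'S FAMILY `(T, □₁, …, □_k)` IS A LAWFUL MEMBER OF THE INDEX OF RECORD FOR EVERY COLLAR WIDTH `ρ`** — n05-c's
`B8SockB9P3ShellModeVacuityUniv.exists_topCube_member_lawsB` (there `L ≤ ρ`) re-run with the nesting field read off `cubeFam_true_anti`; every other line is that
proof's (restriction sets `Λ′₀ = ℤᵈ ∖ □₁` ∕ `cubeLamS`, bond classes `towerBonds`, laws `hbox`∕`hclass`∕`htower`∕`hpart`, №7 under `Lᵏη ≤ 1`, №8, №11, №12).  At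
`ρ = 0` all cubes `□_j`, `1 ≤ j ≤ k`, are the SAME box `Bᵏ(□)`.
[cite: Balaban1985RegularSpaces, (1.131) p.99 («Λ′₀ = T ∖ □₁»), (1.5)–(1.6) p.77, (1.68) p.88, (1.31) p.82, p.86 («𝔅_k»), p.77 («we admit … Ω_j = T_η»)] -/
theorem exists_topCube_member_lawsB_anyWidth (hL : 1 ≤ L) (a : Site d) (M ρ : ℕ) {k : ℕ} (hk : 1 ≤ k)
    {η : ℝ} (hη : 0 < η) (hscale : (L : ℝ) ^ k * η ≤ 1) :
    ∃ i : ZdIdx d L, i.k = k ∧ i.η = η ∧ i.Ω = cubeFam true L a M ρ k ∧ i.Λs 1 0 = (cube L a M ρ k 1)ᶜ ∧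
      i.Λs 1 1 = {z | InBox (sqLo L a ρ k 1) (sqHi L a M ρ k 1) z} ∧ (∀ m j, i.Λb m j = towerBonds L i.Ω (i.Λs m) j) ∧
      IdxB8LawsB L i := by
  classical
  haveI : NeZero L := ⟨by omega⟩
  -- the truncated tower with print's `Λ′₀`
  let ΛT : ℕ → ℕ → Set (Site d) := fun m j =>
    if j = 0 then (if m = 0 then Set.univ else (cube L a M ρ k 1)ᶜ) else cubeLamS L a M ρ k m j
  have hT0 : ∀ m, 1 ≤ m → ΛT m 0 = (cube L a M ρ k 1)ᶜ := fun m hm => by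
    simp only [ΛT, if_pos rfl, if_neg (show m ≠ 0 by omega)]
  have hT00 : ΛT 0 0 = Set.univ := by simp [ΛT]
  have hTpos : ∀ m j, 1 ≤ j → ΛT m j = cubeLamS L a M ρ k m j := fun m j hj => by
    simp only [ΛT, if_neg (show j ≠ 0 by omega)]
  have h10 : cube L a M ρ k 1 ⊆ cube L a M ρ k 0 := cube_succ_subset (by omega)
  have hΩpos : ∀ j, 1 ≤ j → j ≤ k → cubeFam true L a M ρ k j = cubeFam false L a M ρ k j := fun j hj hjk => by
    rw [cubeFam_of_pos true L a M ρ hj hjk, cubeFam_of_pos false L a M ρ hj hjk]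
  -- a level-0 restriction site of the `false` member lies outside `□₁`
  have hlam0 : ∀ y ∈ cubeLamS L a M ρ k k 0, y ∈ (cube L a M ρ k 1)ᶜ := fun y hy => by
    rw [cubeLamS_of_lt L a M ρ k (by omega : 0 < k)] at hy
    exact ((mem_cubeLam_zero_iff hL a M ρ hk y).1 hy).2
  have hself0 : ∀ x : Site d, InBox (tlo L x 0) (thi L x 0) x := fun x i => by
    simp [B8Ineq130.tlo_zero, B8Ineq130.thi_zero]
  refine ⟨⟨η, hη, k, hk, cubeFam true L a M ρ k, cubeFam_true_anti L a M ρ k, ΛT,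
    fun m j => towerBonds L (cubeFam true L a M ρ k) (ΛT m) j,
    towerBonds_hbox L _ ΛT k, towerBonds_hclass L _ ΛT k, ?_, ?_⟩, rfl, rfl, rfl, hT0 1 le_rfl, ?_, fun _ _ => rfl, ?_⟩
  · -- htower
    intro j hj y hy x hx
    rcases Nat.eq_zero_or_pos j with rfl | hjpos
    · rw [cubeFam_true_zero]; exact Set.mem_univ x
    · rw [hTpos k j hjpos] at hy
      rw [hΩpos j hjpos hj]
      exact htower_cubeLam hL a M ρ k j hj y hy x hx
  · -- hpart
    intro x _
    by_cases hx0 : x ∈ cube L a M ρ k 0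
    · obtain ⟨j, hjk, y, hy, hB⟩ := hpart_cubeLam hL a M ρ k x (by rw [cubeFam_false_zero]; exact hx0)
      rcases Nat.eq_zero_or_pos j with rfl | hjpos
      · exact ⟨0, hjk, y, by rw [hT0 k hk]; exact hlam0 y hy, hB⟩
      · exact ⟨j, hjk, y, by rw [hTpos k j hjpos]; exact hy, hB⟩
    · exact ⟨0, Nat.zero_le k, x, by rw [hT0 k hk]; exact fun h => hx0 (h10 h), hself0 x⟩
  · -- `Λs 1 1 = □₁^{(1)}`
    show ΛT 1 1 = _
    rw [hTpos 1 1 le_rfl, cubeLamS_self]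
  · -- the located laws
    refine ⟨⟨hscale, ?_, ?_, ?_⟩, fun _ _ => rfl⟩
    · -- №8 below the top
      intro m hm j hj
      show ΛT m j = ΛT (m + 1) j
      rcases Nat.eq_zero_or_pos j with rfl | hjpos
      · rw [hT0 m (by omega), hT0 (m + 1) (by omega)]
      · rw [hTpos m j hjpos, hTpos (m + 1) j hjpos]
        exact B8SockHFPCubeMember.h8lt_cubeLamS L a M ρ k m hm j hj
    · -- №8 at the top
      intro m hm x
      show x ∈ ΛT m m ↔ x ∈ ΛT (m + 1) m ∨ ∃ y ∈ ΛT (m + 1) (m + 1), x ∈ blockSites L y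
      rcases Nat.eq_zero_or_pos m with rfl | hmpos
      · rw [hT00, hT0 1 le_rfl, hTpos 1 1 le_rfl, cubeLamS_self]
        refine ⟨fun _ => ?_, fun _ => Set.mem_univ x⟩
        by_cases hx1 : x ∈ cube L a M ρ k 1
        · obtain ⟨z, hz, hu⟩ := (mem_cube_iff hL).1 hx1
          refine Or.inr ⟨z, hz, ?_⟩
          rw [mem_blockSites_iff]
          have := (under_iff_blockMap_eq hL 1 z x).1 hu
          rwa [pow_one] at this
        · exact Or.inl hx1
      · rw [hTpos m m hmpos, hTpos (m + 1) m hmpos, hTpos (m + 1) (m + 1) (by omega)]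
        exact B8SockHFPCubeMember.h8top_cubeLamS hL a M ρ k m hm x
    · -- №11 (1.6) at every level
      intro ℓ hℓ w hw
      show ∃ j, ℓ ≤ j ∧ j ≤ k ∧ ∃ y ∈ ΛT k j, Under L (j - ℓ) y w
      rcases Nat.eq_zero_or_pos ℓ with rfl | hℓpos
      · by_cases hw0 : w ∈ cube L a M ρ k 0
        · have hw' : ∀ x, InBox (tlo L w 0) (thi L w 0) x → x ∈ cubeFam false L a M ρ k 0 := by
            intro x hx
            have hxw : x = w := funext fun i => by
              have := hx i; simp [B8Ineq130.tlo_zero, B8Ineq130.thi_zero] at this; omega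
            rw [hxw, cubeFam_false_zero]; exact hw0
          obtain ⟨j, h0j, hjk, y, hy, hU⟩ := B8CubeMemberIdxB8Laws.cover_cubeLamS hL a M ρ k 0 (Nat.zero_le k) w hw'
          rcases Nat.eq_zero_or_pos j with rfl | hjpos
          · exact ⟨0, le_rfl, hjk, y, by rw [hT0 k hk]; exact hlam0 y hy, hU⟩
          · exact ⟨j, h0j, hjk, y, by rw [hTpos k j hjpos]; exact hy, hU⟩
        · refine ⟨0, le_rfl, Nat.zero_le k, w, by rw [hT0 k hk]; exact fun h => hw0 (h10 h), ?_⟩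
          rw [Nat.sub_zero]; exact (B8Eq131Derivation.under_zero_iff L w w).2 rfl
      · have hw' : ∀ x, InBox (tlo L w ℓ) (thi L w ℓ) x → x ∈ cubeFam false L a M ρ k ℓ := by
          intro x hx; rw [← hΩpos ℓ hℓpos hℓ]; exact hw x hx
        obtain ⟨j, hℓj, hjk, y, hy, hU⟩ := B8CubeMemberIdxB8Laws.cover_cubeLamS hL a M ρ k ℓ hℓ w hw'
        exact ⟨j, hℓj, hjk, y, by rw [hTpos k j (by omega)]; exact hy, hU⟩

end Member

/-! ## §2 At collar width `0` the collar hypothesis FAILS at level `2` -/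

section Width0

variable {L : ℕ}

/-- At width `ρ = 0` every cube `□_j`, `j ≤ k`, is the SAME fine box `[Lᵏa, Lᵏ(a + M) − 𝟙]` (`B8Eq131Cubes.cube_eq` with margin `0`). [cite: Balaban1985RegularSpaces, p.98] -/
theorem mem_cube_width0_iff (L : ℕ) (a : Site d) (M : ℕ) {k j : ℕ} (hj : j ≤ k) (x : Site d) :
    x ∈ cube L a M 0 k j ↔ ∀ i, (L : ℤ) ^ k * a i ≤ x i ∧ x i ≤ (L : ℤ) ^ k * (a i + M) - 1 := by
  rw [cube_eq hj]
  simp only [zero_mul, mul_zero, Set.mem_setOf_eq, InBox, bLo, bHi, Nat.cast_zero, sub_zero, add_zero]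

/-- ★ **THE COLLAR HYPOTHESIS FAILS ON PRINT'S TOWER AT COLLAR WIDTH `0`** (`L, M, d ≥ 1`, `k ≥ 2`): at level `2` the bond `⟨z, z + e₀⟩`, `z + e₀ = Lᵏ⁻²a`, has
its end-block `B²(z + e₀) = [Lᵏa, Lᵏa + (L² − 1)𝟙]` inside `□₂ = Bᵏ(□)` (so `EndBlockIn` holds), while the corner `L²z` of `B²(z)` has `0`-th coordinate
`Lᵏa₀ − L² < Lᵏa₀`, outside `□₁ = Bᵏ(□)` — the two-block box is NOT inside `Ω_{2−1}`. [cite: Balaban1985RegularSpaces, (1.4) p.77, p.98, Prop. 7 (1.145) p.100] -/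
theorem not_collar_cubeFam_true_zero (hL : 1 ≤ L) (hd : 1 ≤ d) (a : Site d) {M : ℕ} (hM : 1 ≤ M) {k : ℕ} (hk : 2 ≤ k) :
    ¬ (∀ j, j ≤ k → ∀ (z : Site d) (μ : Fin d), EndBlockIn L (cubeFam true L a M 0 k j) j z μ →
        ∀ x, InBox (loK L j z) (bondHiK L j z μ) x → x ∈ cubeFam true L a M 0 k (j - 1)) := by
  intro h
  set μ : Fin d := ⟨0, hd⟩ with hμ
  set w : Site d := fun i => (L : ℤ) ^ (k - 2) * a i with hw
  set z : Site d := w - e μ with hz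
  have hzw : z + e μ = w := by rw [hz, sub_add_cancel]
  have hL0 : (0 : ℤ) < (L : ℤ) := by exact_mod_cast hL
  have hLk : (L : ℤ) ^ k = (L : ℤ) ^ 2 * (L : ℤ) ^ (k - 2) := by
    rw [← pow_add]; congr 1; omega
  have hL2 : (1 : ℤ) ≤ (L : ℤ) ^ 2 := one_le_pow₀ (by exact_mod_cast hL)
  have hLk2 : (1 : ℤ) ≤ (L : ℤ) ^ (k - 2) := one_le_pow₀ (by exact_mod_cast hL)
  have hMz : (1 : ℤ) ≤ (M : ℤ) := by exact_mod_cast hM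
  -- `B²(w) ⊂ □₂`
  have hend : EndBlockIn L (cubeFam true L a M 0 k 2) 2 z μ := by
    refine Or.inr ?_
    intro x hx
    rw [hzw] at hx
    rw [cubeFam_of_pos true L a M 0 (by norm_num) hk, mem_cube_width0_iff L a M hk]
    intro i
    obtain ⟨h1, h2⟩ := hx i
    rw [tlo_apply] at h1
    rw [thi_apply] at h2
    simp only [hw] at h1 h2
    constructor
    · calc (L : ℤ) ^ k * a i = (L : ℤ) ^ 2 * ((L : ℤ) ^ (k - 2) * a i) := by rw [hLk]; ring
        _ ≤ x i := h1
    · have hP : (1 : ℤ) ≤ (L : ℤ) ^ (k - 2) * (M : ℤ) := by nlinarith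
      have h4 : (L : ℤ) ^ 2 * 1 ≤ (L : ℤ) ^ 2 * ((L : ℤ) ^ (k - 2) * (M : ℤ)) :=
        mul_le_mul_of_nonneg_left hP (by positivity)
      have h3 : (L : ℤ) ^ 2 * ((L : ℤ) ^ (k - 2) * a i + 1) ≤ (L : ℤ) ^ k * (a i + M) := by
        rw [hLk]; nlinarith [h4]
      linarith
  -- the corner of `B²(z)` is a box site outside `□₁`
  have hx : InBox (loK L 2 z) (bondHiK L 2 z μ) (tlo L z 2) :=
    inBox_loK_bondHiK_of_inBox_block L 2 z μ (fun i => by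
      rw [tlo_apply, thi_apply]; constructor <;> nlinarith)
  have hmem := h 2 hk z μ hend (tlo L z 2) hx
  rw [show 2 - 1 = 1 from rfl, cubeFam_of_pos true L a M 0 le_rfl (by omega), mem_cube_width0_iff L a M (by omega)] at hmem
  have h0 := (hmem μ).1
  rw [tlo_apply] at h0
  have hzμ : z μ = (L : ℤ) ^ (k - 2) * a μ - 1 := by
    simp [hz, hw, e_apply]
  rw [hzμ, hLk] at h0
  nlinarith

/-- Hence print's tower at width `0` (`k ≥ 2`) is NOT admissible in the tree's typed (1.3)–(1.4) sense — the contrapositive of this seat's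
`B8Prop7TowerAxialAdmissible.collar_of_domainSeq`. [cite: Balaban1985RegularSpaces, (1.3)–(1.4) p.77] -/
theorem not_domainSeq_cubeFam_true_zero (hL : 1 ≤ L) (hd : 1 ≤ d) (a : Site d) {M : ℕ} (hM : 1 ≤ M) {k : ℕ} (hk : 2 ≤ k) :
    ¬ DomainSeq L (cubeFam true L a M 0 k) := fun hadm =>
  not_collar_cubeFam_true_zero hL hd a hM hk
    (fun j _ z μ hend x hx => collar_of_domainSeq hL (cubeFam_true_zero L a M 0 k) hadm j z μ hend x hx)

end Width0

/-! ## §3 The certificate on the sub-index of record `IdxB8SubB θ` -/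

section Record

variable (θ : Stage3Params)

/-- ★★ **THE SUB-INDEX OF RECORD CONTAINS A LAWFUL MEMBER VIOLATING THE COLLAR HYPOTHESIS**: for every `θ`, print's tower at width `0` and depth `k = 2`
(`η = L⁻²`, `a = 0`, `M = 1`: `Ω = (ℤᵈ, B²(□), B²(□))`, EQUAL non-univ `Ω₁ = Ω₂`) is a term of `IdxB8SubB θ` (§1) at which the collar hypothesis of the two
(1.145) editions fails (§2). [cite: Balaban1985RegularSpaces, (1.3)–(1.4) p.77 (the collar is print's, not the typed index's), (1.131) p.99, p.86] -/
theorem exists_idxB8SubB_not_collar :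
    ∃ j : IdxB8SubB θ, ¬ (∀ l, l ≤ j.1.1.k → ∀ (z : Site θ.D) (μ : Fin θ.D), EndBlockIn θ.L (j.1.1.Ω l) l z μ →
      ∀ x, InBox (loK θ.L l z) (bondHiK θ.L l z μ) x → x ∈ j.1.1.Ω (l - 1)) := by
  have hL : 1 ≤ θ.L := le_trans (by norm_num) θ.two_le_L
  have hD : 1 ≤ θ.D := by have := θ.hd₆; omega
  have hL0 : (0 : ℝ) < θ.L := by exact_mod_cast (show 0 < θ.L by omega)
  have hη : (0 : ℝ) < ((θ.L : ℝ)⁻¹) ^ 2 := pow_pos (inv_pos.mpr hL0) 2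
  have hscale : (θ.L : ℝ) ^ 2 * ((θ.L : ℝ)⁻¹) ^ 2 ≤ 1 := by
    rw [← mul_pow, mul_inv_cancel₀ hL0.ne', one_pow]
  obtain ⟨i, hik, -, hΩ, -, -, -, hlaws⟩ :=
    exists_topCube_member_lawsB_anyWidth (d := θ.D) hL (0 : Site θ.D) 1 0 (show 1 ≤ 2 by norm_num) hη hscale
  have hΩ0 : i.Ω 0 = Set.univ := by rw [hΩ]; exact cubeFam_true_zero θ.L 0 1 0 2
  refine ⟨⟨⟨i, hΩ0⟩, hlaws⟩, ?_⟩
  show ¬ (∀ l, l ≤ i.k → ∀ (z : Site θ.D) (μ : Fin θ.D), EndBlockIn θ.L (i.Ω l) l z μ →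
    ∀ x, InBox (loK θ.L l z) (bondHiK θ.L l z μ) x → x ∈ i.Ω (l - 1))
  rw [hik, hΩ]
  exact not_collar_cubeFam_true_zero hL hD 0 le_rfl le_rfl

/-- ★★ **THE COLLAR LAW IS NOT A LAW OF `IdxB8SubB θ`**: quantified over ALL members of the sub-index of record the collar hypothesis is FALSE (for every `θ`) — a
record face displaying it in that form would hold ex hypothesi falso (cell rule №189); the faces of record key it on sub-families ∕ per member instead.
[cite: Balaban1985RegularSpaces, (1.3)–(1.4) p.77] -/
theorem not_forall_idxB8SubB_collar :
    ¬ ∀ j : IdxB8SubB θ, ∀ l, l ≤ j.1.1.k → ∀ (z : Site θ.D) (μ : Fin θ.D), EndBlockIn θ.L (j.1.1.Ω l) l z μ →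
      ∀ x, InBox (loK θ.L l z) (bondHiK θ.L l z μ) x → x ∈ j.1.1.Ω (l - 1) := fun h => by
  obtain ⟨j, hj⟩ := exists_idxB8SubB_not_collar θ
  exact hj (h j)

/-- ★ **NOR IS ADMISSIBILITY (1.3)–(1.4)**: not every member of `IdxB8SubB θ` is `B8ConstraintBonds.DomainSeq`-admissible (the width-`0` member is not, by
`collar_of_domainSeq`); the admissible sub-family of `B8Prop7TowerAxialAdmissible` is PROPER (and non-empty: `exists_idxB8SubB_domainSeq_topCube`).
[cite: Balaban1985RegularSpaces, (1.3)–(1.4) p.77] -/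
theorem not_forall_idxB8SubB_domainSeq : ¬ ∀ j : IdxB8SubB θ, DomainSeq θ.L j.1.1.Ω := fun h => by
  have hL : 1 ≤ θ.L := le_trans (by norm_num) θ.two_le_L
  obtain ⟨j, hj⟩ := exists_idxB8SubB_not_collar θ
  exact hj (fun l _ z μ hend x hx => collar_of_domainSeq hL j.1.2 (h j) l z μ hend x hx)

end Record

end Literature.MathematicalPhysics.QuantumFieldTheory.Balaban1983to89.B8IdxB8SubBCollarVacuity

end
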